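import Summits.ResolutionOfSingularities.ResolutionOfSingularities.Theorems.EquisingularLiftEquisingularLiftNatSecondOrderAPoints
import HarnessLib

/-!
# [OURS] SECOND-ORDER POINTS, polynomial currency (sequel): the `A₃` NORMAL FORM UP TO ORDER `5`, `f = y₀y₁ + y₂⁴ + Ψ‴` with `Ψ‴ ∈ (y)⁵`
# ARBITRARY, has level exactly `1` — one blow-up leaves one candidate singular point over the vertex, a first-order (one-step) point
# (cruxes `Theses.EquisingularLift.EquisingularLiftNat` / `…NatThree` / `EquisingularLift`, stmt-ResolutionOfSingularities-20038 / -20148 / -15660)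

[OURS · leafhand-res-equisingularlift-11 g0, 2026-08-31; cell `pub/decomp-res`] AI-produced, weaker than expert review; NOT a statement of any manuscript;
nothing here proves resolution of singularities in positive characteristic.  DEF-FREE helper; no `sorry`; standard axioms; ZERO named hypotheses.

Sequel of ✓ `…NatSecondOrderAPoints` (p832392: the bare specimen `y₀y₁ + y₂⁴`).  Here the tail is free: for EVERY `Ψ‴ ∈ (y)⁵` and every field,

* `SecondOrderPoint.sub_C_constantCoeff_mem_span` — `R - C(R(0)) ∈ (T)`; `SecondOrderPoint.X_pow_three_mul_sub_C_mem_pow_four` — hence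
  `T₂³·(R - C(R(0))) ∈ (T)⁴`: the splitting `T₂³R = c·T₂³ + (order ≥ 4)` of the chart-`2` tail;
* ★★ `SecondOrderPoint.A₃_tail_chart₂` — chart `2` of `f = y₀y₁ + y₂⁴ + Ψ‴`: `f(T₂T₀, T₂T₁, T₂) = T₂²·G₂` with
  `G₂ = (T₀T₁ + T₂²) + (c·T₂³ + Ψ'')`, `Ψ'' ∈ (T)⁴` — tangent cone a NODE `Φ' = T₀T₁ + T₂²`, next form `Ψ₁' = c·T₂³`; a prime `P ∋ T₂` containing
  `∂₀G₂, ∂₁G₂` contains all `T_i` (the only candidate singular point of the strict transform on `E` is the origin of chart `2`,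
  ✓ `forall_X_mem_of_sub_mul_mem_span₃`); and THAT point is ONE-STEP: for every chart direction `l` an explicit strict transform of `G₂` with its
  total-transform identity and the Jacobian certificate along its exceptional divisor (✓ `FirstOrderPoint.exists_strictTransform` fed by
  ✓ `FirstOrderPoint.firstOrder_node`, every characteristic);
* ★ `SecondOrderPoint.A₃_tail_charts₀₁` — charts `0`, `1`: regular along `E` (✓ `A_charts_regular_off_origin₂` with `Ψ = y₂⁴ + Ψ‴ ∈ (y)³`);
* ★ `SecondOrderPoint.A₃_tail_not_firstOrder` — and the point itself is NOT first-order (`Φ = y₀y₁`, `Ψ₁ = 0`: ✓ `A₃_not_firstOrder`), so its level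
  is exactly `1` in polynomial currency.

Remaining (scheme side, unchanged): the bridge to ✓ `towerLevel_succ_of_model` (points of the glued chart model ↔ the primes above).  The genuinely
general `A₃` recognition (arbitrary cubic / quartic forms `Ψ₁, Ψ₂` with `Ψ₁(e₂) = 0` and non-zero discriminant `γ - αβ` of the exceptional tangent
cone `(T₀ + βT₂)(T₁ + αT₂) + (γ - αβ)T₂²`) needs in addition the (FO)-transport under the linear change `T₀ + βT₂, T₁ + αT₂` (✓ …NatFirstOrderLinSubst)
— not done here.  Honest label: pure algebra; closes no registered stub of 20038 / 20148 / 15660.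

References: [Hartshorne1977, I Thm. 5.1, II Ex. 7.12]; resolution of `A_k` by point blow-ups (`A_k ↦ A_{k-2}`) is classical; through the cited tree files.
-/

set_option linter.dupNamespace false -- mandated namespace `Summit.<Summit>.<Problem>` of this single-conjunct summit

noncomputable section

open MvPolynomial

namespace Summit.ResolutionOfSingularities.ResolutionOfSingularities.Cruxes.EquisingularLiftNat.Sections

namespace SecondOrderPoint

variable (K : Type) [Field K] {n : ℕ}

/-! ## Splitting off the constant term of the tail -/

/-- `R - C(R(0))` has no constant term, hence lies in the ideal of the variables. [folklore] -/
theorem sub_C_constantCoeff_mem_span (R : MvPolynomial (Fin n) K) :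
    R - C (constantCoeff R) ∈ Ideal.span (Set.range (X : Fin n → MvPolynomial (Fin n) K)) := by
  change R - C (constantCoeff R) ∈ MvPolynomial.idealOfVars (Fin n) K
  rw [← pow_one (MvPolynomial.idealOfVars (Fin n) K), MvPolynomial.mem_pow_idealOfVars_iff']
  intro x hx
  have hx0 : x = 0 := (Finsupp.degree_eq_zero_iff x).mp (Nat.lt_one_iff.mp hx)
  subst hx0
  rw [coeff_sub, coeff_C, if_pos rfl, ← constantCoeff_eq, sub_self]

/-- `T_l³ · (R - C(R(0))) ∈ (T)⁴`. [folklore] -/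
theorem X_pow_three_mul_sub_C_mem_pow_four (l : Fin n) (R : MvPolynomial (Fin n) K) :
    X l ^ 3 * (R - C (constantCoeff R)) ∈ Ideal.span (Set.range (X : Fin n → MvPolynomial (Fin n) K)) ^ 4 := by
  have hX : (X l : MvPolynomial (Fin n) K) ∈ Ideal.span (Set.range (X : Fin n → MvPolynomial (Fin n) K)) :=
    Ideal.subset_span (Set.mem_range_self l)
  have h3 : (X l ^ 3 : MvPolynomial (Fin n) K) ∈ Ideal.span (Set.range (X : Fin n → MvPolynomial (Fin n) K)) ^ 3 :=
    Ideal.pow_mem_pow hX 3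
  have h1 : R - C (constantCoeff R) ∈ Ideal.span (Set.range (X : Fin n → MvPolynomial (Fin n) K)) ^ 1 := by
    rw [pow_one]; exact sub_C_constantCoeff_mem_span K R
  rw [show (4 : ℕ) = 3 + 1 from rfl, pow_add]
  exact Ideal.mul_mem_mul h3 h1

/-! ## ★★ Chart `2` of `y₀y₁ + y₂⁴ + Ψ‴`: a node over the vertex, and its one-step data -/

/-- ★★ **`A₃` up to order `5`, chart `2`.**  `f = y₀y₁ + y₂⁴ + Ψ‴`, `Ψ‴ ∈ (y)⁵`, any field: there are `c ∈ K` and `Ψ'' ∈ (T)⁴` such that with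
`G₂ = (T₀T₁ + T₂²) + (c·T₂³ + Ψ'')` (i) `f(T₂T₀, T₂T₁, T₂) = T₂²·G₂`; (ii) an ideal containing `T₂`, `∂₀G₂`, `∂₁G₂` contains every `T_i` (on the
exceptional divisor the strict transform is singular at most at the origin); (iii) the origin is a ONE-STEP point of `G₂`: for every chart direction `l`
a strict transform `G'` with `G₂(T_l, T_lT_j) = T_l²·G'` passing the Jacobian test at every prime `P ∋ T_l, G'` (node tangent cone, every characteristic).
[cite: Hartshorne1977, I Thm. 5.1, II Ex. 7.12] -/
theorem A₃_tail_chart₂ {Ψt : MvPolynomial (Fin 3) K} (hΨt : Ψt ∈ Ideal.span (Set.range (X : Fin 3 → MvPolynomial (Fin 3) K)) ^ 5) :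
    ∃ (c : K) (Ψ'' : MvPolynomial (Fin 3) K), Ψ'' ∈ Ideal.span (Set.range (X : Fin 3 → MvPolynomial (Fin 3) K)) ^ 4 ∧
      aeval (fun j => X 2 * Function.update (X : Fin 3 → MvPolynomial (Fin 3) K) 2 1 j) (X 0 * X 1 + X 2 ^ 4 + Ψt) =
        X 2 ^ 2 * ((X 0 * X 1 + X 2 ^ 2) + (C c * X 2 ^ 3 + Ψ'')) ∧
      (∀ P : Ideal (MvPolynomial (Fin 3) K), (X 2 : MvPolynomial (Fin 3) K) ∈ P →
        pderiv 0 ((X 0 * X 1 + X 2 ^ 2) + (C c * X 2 ^ 3 + Ψ'')) ∈ P → pderiv 1 ((X 0 * X 1 + X 2 ^ 2) + (C c * X 2 ^ 3 + Ψ'')) ∈ P →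
        ∀ i, (X i : MvPolynomial (Fin 3) K) ∈ P) ∧
      ∀ l : Fin 3, ∃ G' : MvPolynomial (Fin 3) K,
        aeval (fun j => X l * Function.update (X : Fin 3 → MvPolynomial (Fin 3) K) l 1 j) ((X 0 * X 1 + X 2 ^ 2) + (C c * X 2 ^ 3 + Ψ'')) =
          X l ^ 2 * G' ∧
        ∀ P : Ideal (MvPolynomial (Fin 3) K), P.IsPrime → (X l : MvPolynomial (Fin 3) K) ∈ P → G' ∈ P → ∃ j, pderiv j G' ∉ P := by
  obtain ⟨R, hR⟩ := FirstOrderPoint.exists_aeval_subst_eq_pow_mul K 2 hΨt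
  refine ⟨constantCoeff R, X 2 ^ 3 * (R - C (constantCoeff R)), X_pow_three_mul_sub_C_mem_pow_four K 2 R, ?_, ?_, ?_⟩
  · -- (i) the total-transform identity
    rw [map_add, map_add, aeval_subst_X_mul_X_of_ne K 2 0 1 (by decide) (by decide), map_pow, aeval_X, Function.update_self, hR]
    ring
  · -- (ii) product chart: `G₂ - T₀T₁ ∈ (T₂)`
    intro P h2 h0 h1 i
    refine forall_X_mem_of_sub_mul_mem_span₃ K ?_ P h2 h0 h1 i
    exact Ideal.mem_span_singleton'.mpr ⟨X 2 + C (constantCoeff R) * X 2 ^ 2 + X 2 ^ 2 * (R - C (constantCoeff R)), by ring⟩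
  · -- (iii) the origin of chart `2` is first-order: node tangent cone, (FO) by `firstOrder_node`
    intro l
    have hΦ : (X 0 * X 1 + X 2 ^ 2 : MvPolynomial (Fin 3) K).IsHomogeneous 2 := by
      refine IsHomogeneous.add ?_ (isHomogeneous_X_pow 2 2)
      simpa using (isHomogeneous_X K (0 : Fin 3)).mul (isHomogeneous_X K (1 : Fin 3))
    have hΨ₁ : (C (constantCoeff R) * X 2 ^ 3 : MvPolynomial (Fin 3) K).IsHomogeneous (2 + 1) := by
      simpa using (isHomogeneous_C (Fin 3) (constantCoeff R)).mul (isHomogeneous_X_pow (2 : Fin 3) 3)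
    exact FirstOrderPoint.exists_strictTransform K (X 0 * X 1 + X 2 ^ 2) (C (constantCoeff R) * X 2 ^ 3)
      (X 2 ^ 3 * (R - C (constantCoeff R))) hΦ hΨ₁ (X_pow_three_mul_sub_C_mem_pow_four K 2 R)
      (fun P hP hΦP hdP hΨP => FirstOrderPoint.firstOrder_node K _ P hP hΦP hdP hΨP) l

/-- ★ **`A₃` up to order `5`, charts `0` and `1`**: regular along the exceptional divisor (graph charts), by ✓ `A_charts_regular_off_origin₂` with
`Ψ = y₂⁴ + Ψ‴ ∈ (y)³`. [cite: Hartshorne1977, I Thm. 5.1, II Ex. 7.12] -/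
theorem A₃_tail_charts₀₁ {Ψt : MvPolynomial (Fin 3) K} (hΨt : Ψt ∈ Ideal.span (Set.range (X : Fin 3 → MvPolynomial (Fin 3) K)) ^ 5) :
    (∃ G : MvPolynomial (Fin 3) K,
      aeval (fun j => X 0 * Function.update (X : Fin 3 → MvPolynomial (Fin 3) K) 0 1 j) (X 0 * X 1 + X 2 ^ 4 + Ψt) = X 0 ^ 2 * G ∧
      ∀ P : Ideal (MvPolynomial (Fin 3) K), P.IsPrime → (X 0 : MvPolynomial (Fin 3) K) ∈ P → ∃ j, pderiv j G ∉ P) ∧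
    (∃ G : MvPolynomial (Fin 3) K,
      aeval (fun j => X 1 * Function.update (X : Fin 3 → MvPolynomial (Fin 3) K) 1 1 j) (X 0 * X 1 + X 2 ^ 4 + Ψt) = X 1 ^ 2 * G ∧
      ∀ P : Ideal (MvPolynomial (Fin 3) K), P.IsPrime → (X 1 : MvPolynomial (Fin 3) K) ∈ P → ∃ j, pderiv j G ∉ P) := by
  have hΨ : (X 2 ^ 4 + Ψt : MvPolynomial (Fin 3) K) ∈ Ideal.span (Set.range (X : Fin 3 → MvPolynomial (Fin 3) K)) ^ 3 :=
    Ideal.add_mem _ (A₃_tail_mem_pow K) (Ideal.pow_le_pow_right (by norm_num) hΨt)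
  obtain ⟨h0, h1, -⟩ := A_charts_regular_off_origin₂ K hΨ
  rw [add_assoc]
  exact ⟨h0, h1⟩

/-- ★ **`A₃` up to order `5` is NOT first-order**: its tangent cone is `Φ = y₀y₁` and its cubic form is `Ψ₁ = 0` (`y₂⁴ + Ψ‴ ∈ (y)⁴`), so the
closed-point form of (FO) fails at `b = e₂` (✓ `A₃_not_firstOrder`); together with `A₃_tail_chart₂` / `A₃_tail_charts₀₁` the point has level exactly `1`
in polynomial currency.  Recorded with the order-`4` membership of the tail that makes `(Φ, Ψ₁, Ψ') = (y₀y₁, 0, y₂⁴ + Ψ‴)` the first-order splitting.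
[folklore] -/
theorem A₃_tail_not_firstOrder {Ψt : MvPolynomial (Fin 3) K} (hΨt : Ψt ∈ Ideal.span (Set.range (X : Fin 3 → MvPolynomial (Fin 3) K)) ^ 5) :
    (X 2 ^ 4 + Ψt : MvPolynomial (Fin 3) K) ∈ Ideal.span (Set.range (X : Fin 3 → MvPolynomial (Fin 3) K)) ^ (2 + 2) ∧
    ¬ (∀ b : Fin 3 → K, aeval b (X 0 * X 1 : MvPolynomial (Fin 3) K) = 0 →
        (∀ i, aeval b (pderiv i (X 0 * X 1 : MvPolynomial (Fin 3) K)) = 0) → aeval b (0 : MvPolynomial (Fin 3) K) = 0 → b = 0) := by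
  have hX : (X 2 : MvPolynomial (Fin 3) K) ∈ Ideal.span (Set.range (X : Fin 3 → MvPolynomial (Fin 3) K)) :=
    Ideal.subset_span (Set.mem_range_self (2 : Fin 3))
  exact ⟨Ideal.add_mem _ (Ideal.pow_mem_pow hX 4) (Ideal.pow_le_pow_right (by norm_num) hΨt), A₃_not_firstOrder K⟩

end SecondOrderPoint

end Summit.ResolutionOfSingularities.ResolutionOfSingularities.Cruxes.EquisingularLiftNat.Sections

end
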